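import Mathlib
import HarnessLib

/-!
# Route `RadicialJung`, crux `CleanModels` (stmt-15917) — (C-curve) sub-line, brick S5a-core: the UNIT CASE at a discrete valuation ring with perfect
# residue field

Lead `res-B-lead-1` g6 (plan `Cruxes/CleanModels/Lines/Sketch-memo-Ccurve-plan.md` §1 S5a).  OURS · counted 0.  Nothing here proves resolution in
characteristic `p`; resolution in char `p` is NOT proved.

Pure commutative algebra.  `D` a discrete valuation ring of characteristic `p` with uniformizer `z` whose residue field is perfect (every element of `D` is a
`p`-th power modulo the maximal ideal), `w ∈ D`.
* `addVal_sum_eq_inf_of_pairwise` — no cancellation: if the non-zero terms of a finite sum have pairwise distinct values, the value of the sum is the least value.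
* `unitCase_bound` — if `d^p · w = Σ_{j<p} w_j^p z^j` with some `w_j ≠ 0`, `j ≠ 0` (a witness that `w ∉ Frac(D)^p` when `{z^j}` spans `Frac D`
  over its `p`-th powers, e.g. `[κ : κ^p] = p`), then `v(w − c^p) ≤ p·v(w_j) + j` for EVERY `c ∈ D` (the terms `(w_j − δ_{j0} d c)^p z^j` have values `≡ j mod p`).
* `unitCase_core` — if `v(w − c^p)` is bounded over `c ∈ D`, then at a maximizing `c` the value is prime to `p` (else the leading coefficient is a `p`-th power
  residue and `c + e z^{i/p}` does better): `w − c^p = u · z^i`, `u` a unit, `p ∤ i`.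
* `exists_sub_pow_eq_unit_mul_pow` — the two combined.  Used by the closed-point persist of the (C-curve) sub-line at the DVR `O_{C,P}` of the centre curve:
  a unit `w` of `O_{B,C}` whose residue is not a `p`-th power in `κ(C)` becomes, after subtracting a `p`-th power, `z̄^i ·` unit with `p ∤ i` (then form (1)).
-/

noncomputable section

set_option linter.dupNamespace false

open IsDiscreteValuationRing

namespace Summit.ResolutionOfSingularities.ResolutionOfSingularities.Theorems.RadicialJung.CleanModels.Ccurve

variable {D : Type} [CommRing D] [IsDomain D] [IsDiscreteValuationRing D]

/-- **No cancellation between terms of distinct values**: if the non-zero terms of a finite sum have pairwise distinct additive values, the value of the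
sum is the infimum of the values of the terms. [folklore] -/
theorem addVal_sum_eq_inf_of_pairwise {ι : Type} [DecidableEq ι] (s : Finset ι) (f : ι → D)
    (h : ∀ i ∈ s, ∀ j ∈ s, i ≠ j → f i ≠ 0 → addVal D (f i) ≠ addVal D (f j)) :
    addVal D (∑ i ∈ s, f i) = s.inf (fun i => addVal D (f i)) := by
  induction s using Finset.induction_on with
  | empty => simp
  | insert a s ha ih =>
    have h' : ∀ i ∈ s, ∀ j ∈ s, i ≠ j → f i ≠ 0 → addVal D (f i) ≠ addVal D (f j) :=
      fun i hi j hj hij hi0 => h i (Finset.mem_insert_of_mem hi) j (Finset.mem_insert_of_mem hj) hij hi0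
    rw [Finset.sum_insert ha, Finset.inf_insert, ← ih h']
    by_cases hfa : f a = 0
    · simp [hfa]
    by_cases hne : addVal D (f a) = addVal D (∑ i ∈ s, f i)
    swap
    · exact AddValuation.map_add_of_distinct_val _ hne
    exfalso
    -- the value of `f a` is finite and attained by some `f j`, `j ∈ s`
    have hfin : addVal D (f a) ≠ ⊤ := by rw [Ne, addVal_eq_top_iff]; exact hfa
    rw [ih h'] at hne
    rcases s.eq_empty_or_nonempty with rfl | hsne
    · simp at hne; exact hfin hne
    obtain ⟨j, hj, hmin⟩ := Finset.exists_min_image s (fun i => addVal D (f i)) hsne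
    have hinf : s.inf (fun i => addVal D (f i)) = addVal D (f j) :=
      le_antisymm (Finset.inf_le hj) (Finset.le_inf fun i hi => hmin i hi)
    rw [hinf] at hne
    have haj : a ≠ j := fun e => ha (e ▸ hj)
    exact h a (Finset.mem_insert_self a s) j (Finset.mem_insert_of_mem hj) haj hfa hne

/-- The value of an `n`-th power times `z^j`: `v(a^n z^j) = n·v(a) + j`. [folklore] -/
theorem addVal_pow_mul_pow (n : ℕ) {z : D} (hz : Irreducible z) (a : D) (j : ℕ) :
    addVal D (a ^ n * z ^ j) = n • addVal D a + j := by
  rw [addVal_mul, addVal_pow, addVal_pow, addVal_uniformizer hz]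
  simp

variable (p : ℕ) [hp : Fact p.Prime]

/-- Two values `p·m + j` and `p·m' + j'` in `ℕ∞` with `m` finite and `j ≠ j'` both `< p` are distinct. [folklore] -/
theorem ne_of_mod_ne {m m' : ℕ∞} (hm : m ≠ ⊤) {j j' : ℕ} (hj : j < p) (hj' : j' < p) (hjj' : j ≠ j') :
    p • m + (j : ℕ∞) ≠ p • m' + (j' : ℕ∞) := by
  intro h
  lift m to ℕ using hm
  have hlhs : p • (m : ℕ∞) + (j : ℕ∞) ≠ ⊤ := by
    rw [nsmul_eq_mul]; exact_mod_cast ENat.coe_ne_top (p * m + j)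
  rcases eq_or_ne m' ⊤ with rfl | hm'
  · apply hlhs
    rw [h, nsmul_eq_mul, ENat.mul_top (by exact_mod_cast hp.out.ne_zero), top_add]
  lift m' to ℕ using hm'
  have h' : p * m + j = p * m' + j' := by
    rw [nsmul_eq_mul, nsmul_eq_mul] at h
    exact_mod_cast h
  have h1 : (j + p * m) % p = j := by rw [Nat.add_mul_mod_self_left, Nat.mod_eq_of_lt hj]
  have h2 : (j' + p * m') % p = j' := by rw [Nat.add_mul_mod_self_left, Nat.mod_eq_of_lt hj']
  apply hjj'
  rw [← h1, ← h2, add_comm j, add_comm j', h']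

/-- **The bound (S5a).**  If `d^p · w = Σ_{j<p} w_j^p z^j` then for every `c ∈ D` and every `j₀ ≠ 0`,
`v(w − c^p) ≤ p·v(w_{j₀}) + j₀` (vacuous when `w_{j₀} = 0`): indeed `d^p (w − c^p) = Σ_j (w_j − δ_{j0} d c)^p z^j` has terms of pairwise distinct values `≡ j (mod p)`, so no
cancellation occurs. [folklore] -/
theorem unitCase_bound [CharP D p] {z : D} (hz : Irreducible z) (w d : D) (ws : Fin p → D)
    (hrep : d ^ p * w = ∑ j : Fin p, ws j ^ p * z ^ (j : ℕ)) (j₀ : Fin p) (hj₀ : (j₀ : ℕ) ≠ 0) (c : D) :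
    addVal D (w - c ^ p) ≤ p • addVal D (ws j₀) + (j₀ : ℕ) := by
  classical
  -- the modified family: subtract `d c` from the `j = 0` coefficient
  set ws' : Fin p → D := fun j => if (j : ℕ) = 0 then ws j - d * c else ws j with hws'
  have hsum : d ^ p * (w - c ^ p) = ∑ j : Fin p, ws' j ^ p * z ^ (j : ℕ) := by
    have h0 : (⟨0, hp.out.pos⟩ : Fin p) ∈ (Finset.univ : Finset (Fin p)) := Finset.mem_univ _
    rw [mul_sub, hrep, ← mul_pow]
    rw [← Finset.add_sum_erase _ _ h0, ← Finset.add_sum_erase _ _ h0]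
    have hrest : ∑ j ∈ Finset.univ.erase (⟨0, hp.out.pos⟩ : Fin p), ws' j ^ p * z ^ (j : ℕ) =
        ∑ j ∈ Finset.univ.erase (⟨0, hp.out.pos⟩ : Fin p), ws j ^ p * z ^ (j : ℕ) := by
      refine Finset.sum_congr rfl fun j hj => ?_
      have hj0 : (j : ℕ) ≠ 0 := fun e => (Finset.ne_of_mem_erase hj) (Fin.ext e)
      simp only [hws']
      rw [if_neg hj0]
    rw [hrest]
    simp only [hws', if_true, pow_zero, mul_one]
    rw [sub_pow_char (ws _) (d * c)]
    ring
  have hws'j₀ : ws' j₀ = ws j₀ := by simp only [hws']; rw [if_neg hj₀]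
  -- values of the terms are pairwise distinct
  have hdist : ∀ i ∈ (Finset.univ : Finset (Fin p)), ∀ j ∈ (Finset.univ : Finset (Fin p)), i ≠ j →
      ws' i ^ p * z ^ (i : ℕ) ≠ 0 → addVal D (ws' i ^ p * z ^ (i : ℕ)) ≠ addVal D (ws' j ^ p * z ^ (j : ℕ)) := by
    intro i _ j _ hij hi0
    rw [addVal_pow_mul_pow p hz, addVal_pow_mul_pow p hz]
    have hi0' : ws' i ≠ 0 := by
      rintro e; apply hi0; rw [e, zero_pow hp.out.ne_zero, zero_mul]
    refine ne_of_mod_ne p (by rwa [Ne, addVal_eq_top_iff]) i.2 j.2 (fun e => hij (Fin.ext e))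
  have hval : addVal D (d ^ p * (w - c ^ p)) = Finset.univ.inf (fun j : Fin p => addVal D (ws' j ^ p * z ^ (j : ℕ))) := by
    rw [hsum]; exact addVal_sum_eq_inf_of_pairwise _ _ hdist
  have hle : addVal D (d ^ p * (w - c ^ p)) ≤ addVal D (ws' j₀ ^ p * z ^ (j₀ : ℕ)) := by
    rw [hval]; exact Finset.inf_le (Finset.mem_univ _)
  rw [hws'j₀, addVal_pow_mul_pow p hz, addVal_mul] at hle
  exact le_trans le_add_self hle

/-- **The core (S5a).**  If `v(w − c^p)` is bounded as `c` ranges over `D` and the residue field of `D` is perfect, then for some `c` the element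
`w − c^p` is a unit times `z^i` with `p ∤ i` — at a `c` maximizing the value, `p ∣ i` would let one improve by `c ↦ c + e z^{i/p}` with `e^p ≡` the unit. [folklore] -/
theorem unitCase_core [CharP D p] {z : D} (hz : Irreducible z) (hperf : ∀ u : D, ∃ e : D, u - e ^ p ∈ IsLocalRing.maximalIdeal D)
    (w : D) (M : ℕ) (hbound : ∀ c : D, addVal D (w - c ^ p) ≤ M) :
    ∃ (c : D) (i : ℕ) (u : Dˣ), ¬ p ∣ i ∧ w - c ^ p = u * z ^ i := by
  classical
  -- the achievable values
  let P : ℕ → Prop := fun n => ∃ c : D, addVal D (w - c ^ p) = n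
  have hne : ∀ c : D, w - c ^ p ≠ 0 := by
    intro c h0
    have := hbound c
    rw [h0, addVal_zero, top_le_iff] at this
    exact ENat.coe_ne_top _ this
  have hfin : ∀ c : D, ∃ n : ℕ, addVal D (w - c ^ p) = n ∧ n ≤ M := by
    intro c
    have hlt : addVal D (w - c ^ p) ≠ ⊤ := by rw [Ne, addVal_eq_top_iff]; exact hne c
    obtain ⟨n, hn⟩ := ENat.ne_top_iff_exists.mp hlt
    refine ⟨n, hn.symm, ?_⟩
    have := hbound c
    rw [← hn] at this
    exact_mod_cast this
  set i := Nat.findGreatest P M with hi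
  obtain ⟨n₀, hn₀, hn₀M⟩ := hfin 0
  have hPi : P i := Nat.findGreatest_spec hn₀M ⟨0, hn₀⟩
  obtain ⟨c, hc⟩ := hPi
  -- factor `w - c^p = u z^i`
  obtain ⟨i', u, hu⟩ := eq_unit_mul_pow_irreducible (hne c) hz
  have hii' : i' = i := by
    have h1 : addVal D (w - c ^ p) = i' := addVal_def _ u hz i' hu
    rw [hc] at h1
    exact_mod_cast h1.symm
  rw [hii'] at hu
  refine ⟨c, i, u, ?_, hu⟩
  -- `p ∣ i'` contradicts maximality
  rintro ⟨m, hm⟩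
  obtain ⟨e, he⟩ := hperf u
  rw [hz.maximalIdeal_eq, Ideal.mem_span_singleton] at he
  obtain ⟨r, hr⟩ := he
  set c' := c + e * z ^ m with hc'
  have hkey : w - c' ^ p = z ^ (i + 1) * r := by
    have hfrob : c' ^ p = c ^ p + e ^ p * z ^ i := by
      rw [hc', add_pow_char c (e * z ^ m), mul_pow, ← pow_mul, mul_comm m p, ← hm]
    calc w - c' ^ p = (w - c ^ p) - e ^ p * z ^ i := by rw [hfrob]; ring
      _ = (u - e ^ p) * z ^ i := by rw [hu]; ring
      _ = z ^ (i + 1) * r := by rw [hr]; ring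
  obtain ⟨n', hn', hn'M⟩ := hfin c'
  have hge : ((i + 1 : ℕ) : ℕ∞) ≤ addVal D (w - c' ^ p) := by
    rw [hkey, addVal_mul, addVal_pow, addVal_uniformizer hz]
    simp
  rw [hn'] at hge
  have h1 : i + 1 ≤ n' := by exact_mod_cast hge
  have h2 : n' ≤ i := by rw [hi]; exact Nat.le_findGreatest hn'M ⟨c', hn'⟩
  omega

/-- **S5a-core of the (C-curve) plan** — in a discrete valuation ring `D` of characteristic `p` with uniformizer `z` and PERFECT residue field, an element
`w` with a representation `d^p w = Σ_{j<p} w_j^p z^j` having a non-zero coefficient at some `j ≠ 0` (so `d ≠ 0` and `w ∉ Frac(D)^p`) satisfies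
`w − c^p = u · z^i` for some `c ∈ D`, a unit `u` and an exponent `i` PRIME TO `p`. [folklore] -/
theorem exists_sub_pow_eq_unit_mul_pow [CharP D p] {z : D} (hz : Irreducible z)
    (hperf : ∀ u : D, ∃ e : D, u - e ^ p ∈ IsLocalRing.maximalIdeal D)
    (w d : D) (ws : Fin p → D) (hrep : d ^ p * w = ∑ j : Fin p, ws j ^ p * z ^ (j : ℕ))
    (j₀ : Fin p) (hj₀ : (j₀ : ℕ) ≠ 0) (hw₀ : ws j₀ ≠ 0) :
    ∃ (c : D) (i : ℕ) (u : Dˣ), ¬ p ∣ i ∧ w - c ^ p = u * z ^ i := by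
  have hfin : addVal D (ws j₀) ≠ ⊤ := by rw [Ne, addVal_eq_top_iff]; exact hw₀
  obtain ⟨m, hm⟩ := ENat.ne_top_iff_exists.mp hfin
  refine unitCase_core p hz hperf w (p * m + j₀) fun c => ?_
  have := unitCase_bound p hz w d ws hrep j₀ hj₀ c
  rw [← hm] at this
  exact_mod_cast this

end Summit.ResolutionOfSingularities.ResolutionOfSingularities.Theorems.RadicialJung.CleanModels.Ccurve

end
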